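import Literature.NumberTheory.EllipticCurves.ComplexTorus
import Mathlib.AlgebraicGeometry.EllipticCurve.Affine.Point
import HarnessLib

/-!
# The CM endomorphism in the affine chart: the algebra map `ℂ[E_Λ] → ℂ[E_Λ][1/Q]`

For the curve `E_Λ : y² = x³ - (g₂/4)x - g₃/4` of a period pair and polynomials `P, Q ∈ ℂ[X]`
satisfying the transformation identity `(H1)` `f·(P'Q − PQ')² = w²(4P³ − g₂PQ² − g₃Q³)Q`,
`f = 4X³ − g₂X − g₃` (Cox, *Primes of the form x² + ny²*, Prop. 14.9: `℘(wz) = (P/Q)(℘ z)`,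
`℘'(wz) = w⁻¹(P/Q)'(℘ z)℘'(z)`), the substitution `x ↦ P/Q`, `y ↦ (P'Q − PQ')·y/(wQ²)` respects the
Weierstrass equation, hence defines a ring homomorphism out of the coordinate ring into any ring in
which `Q(x)` is inverted (`exists_ringHom_of_transformation`, def-free). This is the affine-chart
incarnation of the complex multiplication `[w]` of `E_Λ` (the sequel turns it into an endomorphism of
the abelian variety `E_Λ` by Milne's extension theorem and rigidity).
-/

noncomputable section

-- every declaration of this problem lives in `Summit.HodgeConjecture.HodgeConjecture.…`
set_option linter.dupNamespace false

open Polynomial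
open scoped Polynomial.Bivariate
open WeierstrassCurve.Affine (CoordinateRing.mk)

namespace Summit.HodgeConjecture.HodgeConjecture.Theorems.WeilTwelvefoldsSqrtMinus7.AmnesicSecantSheaves

/-- The Weierstrass polynomial of `E_Λ` is `Y² − (X³ − (g₂/4)X − g₃/4)`. [folklore] -/
theorem curve_polynomial_eq (L : PeriodPair) :
    L.curve.toAffine.polynomial = Polynomial.X ^ 2 - C (X ^ 3 + C (-L.g₂ / 4) * X + C (-L.g₃ / 4)) := by
  rw [WeierstrassCurve.Affine.polynomial]
  have h1 : L.curve.toAffine.a₁ = 0 := rfl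
  have h2 : L.curve.toAffine.a₂ = 0 := rfl
  have h3 : L.curve.toAffine.a₃ = 0 := rfl
  have h4 : L.curve.toAffine.a₄ = -L.g₂ / 4 := rfl
  have h6 : L.curve.toAffine.a₆ = -L.g₃ / 4 := rfl
  rw [h1, h2, h3, h4, h6]
  simp only [map_zero, zero_mul, add_zero]

/-- In `ℂ[E_Λ]`: `y² = x³ − (g₂/4)x − g₃/4`, i.e. `mk Y² = CoordinateRing.mk L.curve.toAffine (C f₄)`. [folklore] -/
theorem mk_Y_sq (L : PeriodPair) :
    WeierstrassCurve.Affine.CoordinateRing.mk L.curve.toAffine (Polynomial.X ^ 2) =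
      WeierstrassCurve.Affine.CoordinateRing.mk L.curve.toAffine
        (C (X ^ 3 + C (-L.g₂ / 4) * X + C (-L.g₃ / 4))) := by
  rw [← sub_eq_zero, ← map_sub, ← curve_polynomial_eq]
  exact AdjoinRoot.mk_self

/-- `(H1)` without the factor `4`: `w²(P³Q + a₄PQ³ + a₆Q⁴) = (P'Q − PQ')²(X³ + a₄X + a₆)` with
`a₄ = −g₂/4`, `a₆ = −g₃/4`. [cite: Cox2013, Prop. 14.9 (PDF pp. 318–319)] -/
theorem transformation_identity_monic (L : PeriodPair) {w : ℂ} {P Q : ℂ[X]}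
    (h1 : (C 4 * X ^ 3 - C L.g₂ * X - C L.g₃) * (derivative P * Q - P * derivative Q) ^ 2 =
      C (w ^ 2) * ((C 4 * P ^ 3 - C L.g₂ * P * Q ^ 2 - C L.g₃ * Q ^ 3) * Q)) :
    C (w ^ 2) * (P ^ 3 * Q + C (-L.g₂ / 4) * P * Q ^ 3 + C (-L.g₃ / 4) * Q ^ 4) =
      (derivative P * Q - P * derivative Q) ^ 2 * (X ^ 3 + C (-L.g₂ / 4) * X + C (-L.g₃ / 4)) := by
  have hc4 : C (4 : ℂ) * C (-L.g₂ / 4) = -C L.g₂ := by rw [← C_mul, ← C_neg]; congr 1; ring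
  have hc6 : C (4 : ℂ) * C (-L.g₃ / 4) = -C L.g₃ := by rw [← C_mul, ← C_neg]; congr 1; ring
  have h4 : (C (4 : ℂ) : ℂ[X]) ≠ 0 := by rw [Ne, C_eq_zero]; norm_num
  apply mul_left_cancel₀ h4
  generalize hDD : derivative P * Q - P * derivative Q = D at h1 ⊢
  generalize C (w ^ 2) = cw at h1 ⊢
  generalize C L.g₂ = g2 at h1 hc4 ⊢
  generalize C L.g₃ = g3 at h1 hc6 ⊢
  generalize C (-L.g₂ / 4) = a4 at hc4 ⊢
  generalize C (-L.g₃ / 4) = a6 at hc6 ⊢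
  generalize (C (4 : ℂ) : ℂ[X]) = c4 at h1 hc4 hc6 ⊢
  linear_combination (-1 : ℂ[X]) * h1 + (cw * P * Q ^ 3 - D ^ 2 * X) * hc4 +
    (cw * Q ^ 4 - D ^ 2) * hc6

/-- **The chart algebra map of a transformation pair.** For `w ≠ 0` and `P, Q ∈ ℂ[X]` satisfying
`(H1)` for `(g₂(Λ), g₃(Λ))`, and any commutative ring `S` with a map `i₀ : ℂ[E_Λ] → S` inverting
`Q(x)` (`i₀(Q)·u = 1`), there is a ring homomorphism `θ : ℂ[E_Λ] → S`, `ℂ`-linear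
(`θ ∘ ℂ = i₀ ∘ ℂ`), with `θ(x) = i₀(P)·u` and `θ(y) = i₀(P'Q − PQ')·i₀(y)·u²·w⁻¹` (Cox, Prop. 14.9:
`[w](x, y) = ((P/Q)(x), w⁻¹(P/Q)'(x)·y)`; here `y = ℘'/2`). Def-free (an `∃`).
[cite: Cox2013, Prop. 14.9 (PDF pp. 318–319)] -/
theorem exists_ringHom_of_transformation (L : PeriodPair) {w : ℂ} (hw : w ≠ 0) {P Q : ℂ[X]}
    (h1 : (C 4 * X ^ 3 - C L.g₂ * X - C L.g₃) * (derivative P * Q - P * derivative Q) ^ 2 =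
      C (w ^ 2) * ((C 4 * P ^ 3 - C L.g₂ * P * Q ^ 2 - C L.g₃ * Q ^ 3) * Q))
    (S : Type) [CommRing S] (i₀ : L.curve.toAffine.CoordinateRing →+* S) (u : S)
    (hu : i₀ (WeierstrassCurve.Affine.CoordinateRing.mk L.curve.toAffine (C Q)) * u = 1) :
    ∃ θ : L.curve.toAffine.CoordinateRing →+* S,
      θ.comp (algebraMap ℂ _) = i₀.comp (algebraMap ℂ _) ∧
      θ (WeierstrassCurve.Affine.CoordinateRing.mk L.curve.toAffine (C X)) =
        i₀ (WeierstrassCurve.Affine.CoordinateRing.mk L.curve.toAffine (C P)) * u ∧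
      θ (WeierstrassCurve.Affine.CoordinateRing.mk L.curve.toAffine Polynomial.X) =
        i₀ (WeierstrassCurve.Affine.CoordinateRing.mk L.curve.toAffine
            (C (derivative P * Q - P * derivative Q))) *
          i₀ (WeierstrassCurve.Affine.CoordinateRing.mk L.curve.toAffine Polynomial.X) * u ^ 2 *
          i₀ (algebraMap ℂ _ w⁻¹) := by
  set D : ℂ[X] := derivative P * Q - P * derivative Q with hD
  have halg : ∀ c : ℂ, algebraMap ℂ L.curve.toAffine.CoordinateRing c = CoordinateRing.mk L.curve.toAffine (C (C c)) := fun c => rfl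
  -- names for the images in `S`
  set q : S := i₀ (CoordinateRing.mk L.curve.toAffine (C Q)) with hq
  set p : S := i₀ (CoordinateRing.mk L.curve.toAffine (C P)) with hp
  set d : S := i₀ (CoordinateRing.mk L.curve.toAffine (C D)) with hd
  set yy : S := i₀ (CoordinateRing.mk L.curve.toAffine Polynomial.X) with hyy
  set ω : S := i₀ (algebraMap ℂ _ w) with hω
  set ω' : S := i₀ (algebraMap ℂ _ w⁻¹) with hω'
  set α : S := i₀ (algebraMap ℂ _ (-L.g₂ / 4)) with hα
  set β : S := i₀ (algebraMap ℂ _ (-L.g₃ / 4)) with hβ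
  have hqu : q * u = 1 := hu
  have hww : ω * ω' = 1 := by
    rw [hω, hω', ← map_mul, ← map_mul, mul_inv_cancel₀ hw, map_one, map_one]
  -- the values of `x` and `y`
  set Xs : S := p * u with hXs
  set Ys : S := d * yy * u ^ 2 * ω' with hYs
  -- the polynomial identity, pushed to `S`
  have hpoly := transformation_identity_monic L h1
  have hS : ω ^ 2 * (p ^ 3 * q + α * p * q ^ 3 + β * q ^ 4) = d ^ 2 * yy ^ 2 := by
    have e := congrArg (fun r : ℂ[X] => i₀ (CoordinateRing.mk L.curve.toAffine (C r))) hpoly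
    have e2 : i₀ (CoordinateRing.mk L.curve.toAffine (C ((derivative P * Q - P * derivative Q) ^ 2 *
        (X ^ 3 + C (-L.g₂ / 4) * X + C (-L.g₃ / 4))))) = d ^ 2 * yy ^ 2 := by
      rw [map_mul, map_mul, map_mul, ← mk_Y_sq L, map_pow, map_pow, map_pow, map_pow, map_pow, ← hD]
    have e1 : i₀ (CoordinateRing.mk L.curve.toAffine (C (C (w ^ 2) *
        (P ^ 3 * Q + C (-L.g₂ / 4) * P * Q ^ 3 + C (-L.g₃ / 4) * Q ^ 4)))) =
        ω ^ 2 * (p ^ 3 * q + α * p * q ^ 3 + β * q ^ 4) := by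
      rw [hω, hα, hβ, halg, halg, halg, hp, hq]
      simp only [map_mul, map_add, map_pow]
    rw [← e1, e, e2]
  -- Main relation: `Ys² = Xs³ + α Xs + β` in `S`.
  have hrel : Ys ^ 2 - (Xs ^ 3 + α * Xs + β) = 0 := by
    have hunitQ : IsUnit q := IsUnit.of_mul_eq_one _ hqu
    have hunitw : IsUnit ω := IsUnit.of_mul_eq_one _ hww
    apply (hunitQ.pow 4).mul_left_cancel
    apply (hunitw.pow 2).mul_left_cancel
    rw [mul_zero]
    have eL : ω ^ 2 * (q ^ 4 * Ys ^ 2) = d ^ 2 * yy ^ 2 := by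
      rw [hYs]
      calc ω ^ 2 * (q ^ 4 * (d * yy * u ^ 2 * ω') ^ 2)
          = d ^ 2 * yy ^ 2 * (q * u) ^ 4 * (ω * ω') ^ 2 := by ring
        _ = d ^ 2 * yy ^ 2 := by rw [hqu, hww]; ring
    have eR : ω ^ 2 * (q ^ 4 * (Xs ^ 3 + α * Xs + β)) = ω ^ 2 * (p ^ 3 * q + α * p * q ^ 3 + β * q ^ 4) := by
      rw [hXs]
      calc ω ^ 2 * (q ^ 4 * ((p * u) ^ 3 + α * (p * u) + β))
          = ω ^ 2 * (p ^ 3 * q * (q * u) ^ 3 + α * p * q ^ 3 * (q * u) + β * q ^ 4) := by ring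
        _ = ω ^ 2 * (p ^ 3 * q + α * p * q ^ 3 + β * q ^ 4) := by rw [hqu]; ring
    rw [mul_zero, mul_sub, mul_sub, eL, eR, hS, sub_self]
  -- `ℂ[X] → S`, `X ↦ Xs`, and the lift through the Weierstrass relation
  set i : ℂ[X] →+* S := eval₂RingHom (i₀.comp (algebraMap ℂ L.curve.toAffine.CoordinateRing)) Xs with hi
  have hiC : ∀ c : ℂ, i (C c) = i₀ (algebraMap ℂ _ c) := fun c => by
    rw [hi, coe_eval₂RingHom, eval₂_C, RingHom.comp_apply]
  have hiX : i X = Xs := by rw [hi, coe_eval₂RingHom, eval₂_X]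
  have hroot : L.curve.toAffine.polynomial.eval₂ i Ys = 0 := by
    rw [curve_polynomial_eq, eval₂_sub, eval₂_pow, eval₂_X, eval₂_C, map_add, map_add, map_mul,
      map_pow, hiX, hiC, hiC, ← hα, ← hβ]
    exact hrel
  refine ⟨AdjoinRoot.lift i Ys hroot, ?_, ?_, ?_⟩
  · refine RingHom.ext fun c => ?_
    rw [RingHom.comp_apply, RingHom.comp_apply, halg]
    change AdjoinRoot.lift i Ys hroot (AdjoinRoot.mk _ (C (C c))) = _
    rw [AdjoinRoot.lift_mk, eval₂_C, hiC, halg]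
  · change AdjoinRoot.lift i Ys hroot (AdjoinRoot.mk _ (C X)) = _
    rw [AdjoinRoot.lift_mk, eval₂_C, hiX]
  · change AdjoinRoot.lift i Ys hroot (AdjoinRoot.mk _ Polynomial.X) = _
    rw [AdjoinRoot.lift_mk, eval₂_X]

end Summit.HodgeConjecture.HodgeConjecture.Theorems.WeilTwelvefoldsSqrtMinus7.AmnesicSecantSheaves

end
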